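import Summits.BirchSwinnertonDyer.BirchSwinnertonDyer.Theorems.ByReductionTypeAtTwoMultTransportTwistedDescentStrictEngine
import Literature.NumberTheory.GaloisCohomology.PoitouTateSelmerStructuresRealPlaces
import HarnessLib

/-!
# T-42 in the kernel, LXXX — road (S-C′), brick B2 (iv): ASSEMBLY — prescribed local classes at the omitted primes `S₀` are
# realised by ONE class of the non-primitive Selmer group `Sel^{Σ₀}_{2^∞}(E/ℚ_∞)` restricted from the twisted module over `ℚ`
# (engine LXXIX + Poitou–Tate for `ℚ` + the exact-target lift LXXVI)

Cell `bsd-2adic` (run/shared/lean/pub/bsd-2adic/), seat `bsd-2adic-t42` GEN 32 (pen RC-521 «(S-C′) FUNDED», memo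
`t42/DESIGN-T42-ADDENDUM-35.md` §A35.8). HONEST FRAMING: research route; THEOREMS ONLY (no `def`, no named fact, no instance, no
`sorry`); nothing booked; no door or class file is touched; BSD is not proved by any of this. PARTITION: X5@2 multiplicative
GV-transport rows (K4ᵐ B1·O1; the PRINT binder F1 = `Matsuno2008.cor23_lemma24_nonPrimitive_invariants_two`) × p = 2 —
reduces-the-named-input-of; bears_on K4 items 19922 / 19923 (`--supports stmt-BirchSwinnertonDyer-19923`).

## What

**`exists_mem_nonPrimitiveSelmerInfty_localResOver_eq_R`** — under the inputs of the engine `exists_strict_target_orthogonal_R` (LXXIX: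
`ha` on `Sel^{Σ₀}_∞`, `hb`, a Greenberg line package at a place `v₂ ∋ 2` — (d), (c), (i), (iv) exactly as delivered by XXXVII
`exists_tateLine_localKummer_two_inertia` / LXIII `reductionDatum_linePackage` —, the model hypothesis `hmod₁` «no `Γ_ℚ`-fixed point of order `2` on the line» (k5: `P₀ ∉ C₂` / vacuous when `E(ℚ)[2] = 0`),
`δ2`, `δinf`, and EVENTUAL local targets `z_v` at the places of `S₀` in the shape delivered by the tree's twisted local `Γ`-descent
`WeierstrassCurve.exists_twistedTorsionToLocalH1_eq_of_zsmul_conjH1_eq`) together with Poitou–Tate duality for `ℚ` in the five-property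
form (`poitouTate_selmerStructure_duality_real ℚ` — a KERNEL theorem of the tree,
`SchneiderFreeAdditiveX3.PoitouTateReduction.poitouTate_selmerStructure_duality_real_holds ℚ`, taken here as a hypothesis to keep the
cone small), there are a level `J` and a class `x ∈ H¹(Γ_ℚ, E[2^J](χ_u))` whose image `c = twistedTorsionToH1 x` lies in
`Sel^{Σ₀}_{2^∞}(E/ℚ_∞)` (`GreenbergVatsal2000.nonPrimitiveSelmerInfty`), satisfies `u • conj_γ c = c`, and has
`localResOver_v c = z_v` at every `v ∈ S₀` — GV Prop. (2.1)'s «the fixed families are hit», at level `ℚ`, for the TWISTED module,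
on the unobstructed models of road (S-C′). Composition: LXXIX (orthogonal targets) ∘ LXXVI §4 (exact-target lift + reading over `ℚ_∞`).

This is the «hfix» input of the successor's family-level SurjEngine run (GEN 33: B3/B4 ⟹ SURJ₂ ⟹ LXXI/LXXV ⟹ F1ʳ), with NO omitted
prime, NO Prop. 4.9, NO coinvariant input, NO Cassels, and 0 new print; the remaining displayed inputs `ha`/`δ2`/`δinf`/line package
are the ones the multiplicative (XXV, XXIX, XXXVII) and good-ordinary (LXIII, LXVI) chains already discharge.

References: [GreenbergLNM1716] §4 pp. 105–109, 121–126; [GreenbergVatsal2000] §2 Prop. (2.1) (pp. 17–19); [MilneADT2006] I Thm. 4.10;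
[Howard2004HeegnerKolyvagin] Thm. 2.1.11.
-/

set_option autoImplicit false
set_option linter.dupNamespace false

noncomputable section

open scoped Classical AddSubgroup ContRepresentation

namespace Summit.BirchSwinnertonDyer.BirchSwinnertonDyer.Theorems.MultTransportTwistedDescent

open NumberField IsDedekindDomain Field WeierstrassCurve CategoryTheory
  Literature.NumberTheory.EllipticCurves Literature.NumberTheory.EllipticCurves.GreenbergVatsal2000
  Literature.NumberTheory.EllipticCurves.Greenberg1999 Literature.NumberTheory.EllipticCurves.GreenbergSelmer
  Literature.NumberTheory.GaloisRepresentations Literature.NumberTheory.GaloisCohomology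
  Summit.BirchSwinnertonDyer.BirchSwinnertonDyer.Theorems.MultTransportAtTwo
  Summit.BirchSwinnertonDyer.Rank1Residual.X2
open Literature.NumberTheory.GaloisRepresentations.DiscreteGaloisModule (localTatePairingZMod
  unramifiedSubgroup SelmerStructure TateDual)

variable (W : WeierstrassCurve ℚ) [W.IsElliptic] (κ : ZpExtension ℚ 2)

/-- **Prescribed local classes at `S₀` are realised by one class of `Sel^{Σ₀}_{2^∞}(E/ℚ_∞)` restricted from the twisted module over
`ℚ`** (see the module docstring for the inputs; `hPT` is the kernel five-property Poitou–Tate family for `ℚ`).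
[cite: GreenbergVatsal2000, §2 Prop. (2.1) (pp. 17–19)] [cite: GreenbergLNM1716, §4 pp. 122–126]
[cite: Howard2004HeegnerKolyvagin, Thm. 2.1.11 (arXiv:1202.6340 p. 6)] -/
theorem exists_mem_nonPrimitiveSelmerInfty_localResOver_eq_R (hPT : poitouTate_selmerStructure_duality_real ℚ)
    (R : ∀ (W : WeierstrassCurve ℚ) [W.IsElliptic] [W.IsGloballyMinimal], Prop)
    [W.IsGloballyMinimal] (hW : R W)
    (hκ : κ.IsCyclotomic) {γ : absoluteGaloisGroup ℚ} (hγ : κ.IsTopGenerator γ)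
    (S₀ : Finset (HeightOneSpectrum (𝓞 ℚ))) (hS₀ : ∀ v ∈ S₀, ((2 : ℕ) : 𝓞 ℚ) ∉ v.asIdeal)
    (hbad : ∀ v : HeightOneSpectrum (𝓞 ℚ), v ∉ S₀ → ((2 : ℕ) : 𝓞 ℚ) ∉ v.asIdeal → W.HasGoodReductionAt v)
    {u : ℤ} (hu : (2 : ℤ) ∣ u - 1) (hu1 : u ≠ 1)
    {a : ℕ} (ha : ∀ s ∈ nonPrimitiveSelmerInfty W κ (↑S₀ : Set (HeightOneSpectrum (𝓞 ℚ))),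
      W.conjH1 2 κ.kerSubgroup γ s = u • s → 2 ^ a • s = 0)
    {b : ℕ} (hb : ∀ P : W.geomPrimaryTorsion 2, (∀ h : κ.kerSubgroup, h • P = P) → 2 ^ b • P = 0)
    {v₂ : HeightOneSpectrum (𝓞 ℚ)} (hv₂ : ((2 : ℕ) : 𝓞 ℚ) ∈ v₂.asIdeal)
    (N : LocalDatum ℚ (W.geomPrimaryTorsion 2) v₂)
    (hdiv : ∀ c ∈ N.plus, ∃ c' ∈ N.plus, 2 • c' = c)
    (hcard : Nat.card ↥(N.plus ⊓ (↥(W.geomPrimaryTorsion 2))[(2 : ℤ)]) = 2)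
    (hKum : ∀ (f : localSubgroup κ.kerSubgroup (v₂.adicCompletion ℚ) → W.geomPrimaryTorsion 2),
      (∀ τ, f τ ∈ N.plus) → Continuous f →
      (∀ τ₁ τ₂, f (τ₁ * τ₂) = f τ₁ + resGal (K := ℚ) (v₂.adicCompletion ℚ)
        (τ₁ : absoluteGaloisGroup (v₂.adicCompletion ℚ)) • f τ₂) →
      ∃ Q : localPoints W (v₂.adicCompletion ℚ),
        ∀ τ : localSubgroup κ.kerSubgroup (v₂.adicCompletion ℚ),
          pointsMap W (v₂.adicCompletion ℚ) (f τ : W.geomPoints) =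
            (τ : absoluteGaloisGroup (v₂.adicCompletion ℚ)) • Q - Q)
    (hInert : ∀ σ ∈ absInertia (v₂.adicCompletion ℚ), ∀ (n a : ℕ),
      (∀ ζ : (AlgebraicClosure (v₂.adicCompletion ℚ))ˣ, ζ ^ 2 ^ n = 1 →
        Units.map (Field.absoluteGaloisGroup.toAlgEquiv (v₂.adicCompletion ℚ) σ :
          AlgebraicClosure (v₂.adicCompletion ℚ) →* AlgebraicClosure (v₂.adicCompletion ℚ)) ζ = ζ ^ a) →
      ∀ c ∈ N.plus, 2 ^ n • c = 0 → resGal (K := ℚ) (v₂.adicCompletion ℚ) σ • c = a • c)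
    (hmod₁ : ∀ P ∈ N.plus, 2 • P = 0 → (∀ g : absoluteGaloisGroup ℚ, g • P = P) → P = 0)
    (δ2 : ∀ (W : WeierstrassCurve ℚ) [W.IsElliptic] [W.IsGloballyMinimal],
      R W →
      ∀ (κ : ZpExtension ℚ 2) (_hκ : κ.IsCyclotomic) (J : ℕ) (u u' : ℤ) (hu : (2 : ℤ) ∣ u - 1)
        (hu' : (2 : ℤ) ∣ u' - 1) (huu' : ((2 : ℤ) ^ J) ∣ u * u' - 1)
        (e : W.geomTorsion ((2 ^ J : ℕ) : ℤ) → W.geomTorsion ((2 ^ J : ℕ) : ℤ) → AlgebraicClosure ℚ)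
        (hμ : ∀ S T, e S T ^ (2 ^ J) = 1)
        (hadd₁ : ∀ S₁ S₂ T, e (S₁ + S₂) T = e S₁ T * e S₂ T)
        (hadd₂ : ∀ S T₁ T₂, e S (T₁ + T₂) = e S T₁ * e S T₂)
        (hgal : ∀ (σ : absoluteGaloisGroup ℚ) (S T : W.geomTorsion ((2 ^ J : ℕ) : ℤ)),
          σ • e S T = e (σ • S) (σ • T))
        (_halt : ∀ T, e T T = 1) (_hnondeg : ∀ T, (∀ S, e S T = 1) → T = 0),
      ∀ [Finite (W.geomTorsion ((2 ^ J : ℕ) : ℤ))],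
      ∀ (v : HeightOneSpectrum (𝓞 ℚ)), ((2 : ℕ) : 𝓞 ℚ) ∈ v.asIdeal →
      ∀ (ιv : galoisCohomology ((DiscreteGaloisModule.mu ℚ (2 ^ J)).toLocal (Sum.inr v)) 2 →+ ZMod (2 ^ J)),
        Function.Bijective ιv →
      ∀ (y' : galoisCohomology
          ((W.twistedTorsionGaloisModule 2 κ J u' hu').restrictField (v.adicCompletion ℚ)) 1),
        (∀ a : galoisCohomology
            ((W.twistedTorsionGaloisModule 2 κ J u hu).restrictField (v.adicCompletion ℚ)) 1,
          W.twistedTorsionToLocalH1 2 κ J u hu (v.adicCompletion ℚ) a = 0 →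
          localTatePairingZMod (W.twistedTorsionGaloisModule 2 κ J u hu) (2 ^ J) (Sum.inr v) ιv a
            (galoisCohomology.map
              ((W.twistedWeilDual 2 κ J hu hu' huu' e hμ hadd₁ hadd₂ hgal).restrictField
                (v.adicCompletion ℚ)) 1 y') = 0) →
        W.twistedTorsionToLocalH1 2 κ J u' hu' (v.adicCompletion ℚ) y' = 0)
    (δinf : ∀ (W : WeierstrassCurve ℚ) [W.IsElliptic] [W.IsGloballyMinimal],
      R W →
      ∀ (κ : ZpExtension ℚ 2) (_hκ : κ.IsCyclotomic) (J : ℕ) (u u' : ℤ) (hu : (2 : ℤ) ∣ u - 1)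
        (hu' : (2 : ℤ) ∣ u' - 1) (huu' : ((2 : ℤ) ^ J) ∣ u * u' - 1)
        (e : W.geomTorsion ((2 ^ J : ℕ) : ℤ) → W.geomTorsion ((2 ^ J : ℕ) : ℤ) → AlgebraicClosure ℚ)
        (hμ : ∀ S T, e S T ^ (2 ^ J) = 1)
        (hadd₁ : ∀ S₁ S₂ T, e (S₁ + S₂) T = e S₁ T * e S₂ T)
        (hadd₂ : ∀ S T₁ T₂, e S (T₁ + T₂) = e S T₁ * e S T₂)
        (hgal : ∀ (σ : absoluteGaloisGroup ℚ) (S T : W.geomTorsion ((2 ^ J : ℕ) : ℤ)),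
          σ • e S T = e (σ • S) (σ • T))
        (_halt : ∀ T, e T T = 1) (_hnondeg : ∀ T, (∀ S, e S T = 1) → T = 0),
      ∀ [Finite (W.geomTorsion ((2 ^ J : ℕ) : ℤ))],
      ∀ (w : InfinitePlace ℚ)
        (ιw : galoisCohomology ((DiscreteGaloisModule.mu ℚ (2 ^ J)).toLocal (Sum.inl w)) 2 →+ ZMod (2 ^ J)),
        Function.Injective ιw →
      ∀ (y' : galoisCohomology ((W.twistedTorsionGaloisModule 2 κ J u' hu').restrictField w.Completion) 1),
        (∀ a : galoisCohomology ((W.twistedTorsionGaloisModule 2 κ J u hu).restrictField w.Completion) 1,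
          W.twistedTorsionToLocalH1 2 κ J u hu w.Completion a = 0 →
          localTatePairingZMod (W.twistedTorsionGaloisModule 2 κ J u hu) (2 ^ J) (Sum.inl w) ιw a
            (galoisCohomology.map
              ((W.twistedWeilDual 2 κ J hu hu' huu' e hμ hadd₁ hadd₂ hgal).restrictField w.Completion)
              1 y') = 0) →
        W.twistedTorsionToLocalH1 2 κ J u' hu' w.Completion y' = 0)
    (z : Π v : HeightOneSpectrum (𝓞 ℚ),
      discreteH1 (localSubgroup κ.kerSubgroup (v.adicCompletion ℚ)) (localPoints W (v.adicCompletion ℚ)))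
    (hT₀ : ∀ v ∈ S₀, ∃ J₀ : ℕ, ∀ J : ℕ, J₀ ≤ J →
      ∃ t : galoisCohomology ((W.twistedTorsionGaloisModule 2 κ J u hu).restrictField (v.adicCompletion ℚ)) 1,
        W.twistedTorsionToLocalH1 2 κ J u hu (v.adicCompletion ℚ) t = z v) :
    ∃ (J : ℕ) (x : galoisCohomology (W.twistedTorsionGaloisModule 2 κ J u hu) 1),
      W.twistedTorsionToH1 2 κ J u hu x ∈ nonPrimitiveSelmerInfty W κ (↑S₀ : Set (HeightOneSpectrum (𝓞 ℚ))) ∧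
      u • W.conjH1 2 κ.kerSubgroup γ (W.twistedTorsionToH1 2 κ J u hu x) = W.twistedTorsionToH1 2 κ J u hu x ∧
      ∀ v ∈ S₀, W.localResOver 2 κ.kerSubgroup (v.adicCompletion ℚ) (W.twistedTorsionToH1 2 κ J u hu x) = z v := by
  haveI : Fact (Nat.Prime 2) := ⟨Nat.prime_two⟩
  obtain ⟨J, t, htz, horth⟩ := exists_strict_target_orthogonal_R W κ R hW hκ hγ S₀ hS₀ hbad hu hu1 ha hb hv₂ N hdiv hcard
    hKum hInert hmod₁ δ2 δinf z hT₀
  haveI : NeZero (2 ^ J) := ⟨pow_ne_zero _ two_ne_zero⟩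
  haveI hFJ : Finite (W.geomTorsion ((2 ^ J : ℕ) : ℤ)) := finite_geomTorsion_of_neZero W (2 ^ J)
  obtain ⟨inv, hperf, hsum, hUO, hSC, hreal⟩ := hPT (2 ^ J)
  have hS : ∀ v : HeightOneSpectrum (𝓞 ℚ), (Sum.inr v : Place ℚ) ∉ twistedDescentPlaces (K := ℚ) 2 S₀ →
      ((2 ^ J : ℕ) : 𝓞 ℚ) ∉ v.asIdeal ∧
        GaloisRep.IsUnramifiedAt v (W.twistedTorsionGaloisModule 2 κ J u hu) := fun v hv ↦ by
    rw [not_mem_twistedDescentPlaces_iff] at hv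
    exact W.natCast_pow_not_mem_and_isUnramifiedAt_twistedTorsionGaloisModule 2 κ J u hu
      (S₀ := (↑S₀ : Set (HeightOneSpectrum (𝓞 ℚ)))) (fun v hv' hpv ↦ hbad v (by exact_mod_cast hv') hpv)
      (by exact_mod_cast hv.1) hv.2
  obtain ⟨x, hxSel, hxloc⟩ := exists_mem_nonPrimitiveSelmerInfty_localResOver_eq_of_orthogonal W 2 S₀ κ J u hu hκ hSC hS t
    (horth inv hperf hsum hUO hSC hreal)
  exact ⟨J, x, hxSel, W.zsmul_conjH1_twistedTorsionToH1 2 κ J u hu hγ x, fun v hv ↦ by rw [hxloc v hv, htz v hv]⟩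

end Summit.BirchSwinnertonDyer.BirchSwinnertonDyer.Theorems.MultTransportTwistedDescent

end
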